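import Summits.ABC.IUTFork.Cor312NaiveProvPinnedShells
import HarnessLib

/-!
# The PINNED naive model over ANY index skeleton, II: the typed [IUTchIII] Theorem 3.11 for an arbitrary
# family of theta vectors

Record-only file (D-0012) of the abc-iut cell (D-0067 adjudication, ADJUDICATION-SPEC §2 (G-PINNED)/(G3″);
support piece «G-NV-PROV-PINNED» = PR-2 × PROVENANCE, seat abc-iut-w4-d026 gen 3); TAKES NO SIDE.  Part II of
four.  This seat's gen 2 (`Cor312NaiveProvThm311`, p418511) proved c312-1's typed Thm. 3.11
(`Thm311.FullSituation.Statement`) CONTENTFULLY over every index skeleton `T` for the naive model whose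
splitting monoids are the sign-translates of its `thetaVec` (the theta value in every tensor factor).  The
pinned round needs the theta value in ONE factor (Part I's `thetaVec1`, readable honestly by a region
operator); rather than duplicating the proof for that one family, this file proves it for an ARBITRARY family
of theta vectors `θ : ThetaFamily T` (Part I's `PsiOf θ`), everything else as in gen 2:
* (i)(a) `dataOf`: integral structures the unit cylinders `B_0` (PROPER), admissible regions the cylinders,
  log-volume `μ(B_k) = −k·c` at the supported place `v_ℚ⁰` and `0` elsewhere (gen 2's `vol`); (i)(b) splitting
  monoids `PsiOf θ v = {(±θ_{v,j})_j}` at EVERY bad place, acting on `∏_j 𝓘^ℚ(…)` by multiplication by the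
  bad-place coordinates `bcoord v j` of their components; (i)(c) gen 2's `degrees` (objects `p^k𝒪`, degree
  `−k·c` = the global log-volume of `B_k`);
* (ii) `columnOf`: the coric data transported by gen 2's Kummer TWIST `(−1)^m` (KummerA: the twist fixes
  cylinders; KummerB: `PsiOf θ v` is sign-saturated, Part I `image_PsiOf_twist`; KummerC: onto; (Ind3) both
  clauses: unit-group images `B_{m'+1} ⊊ B_0`, archimedean ball images `B_0`);
* (iii) abc-iut-w5-d247's `naiveLink` (`κ_{n,m} = (−1)^m`).
PROVED: `fullOf_statement` — the typed Thm. 3.11 (i) ∧ (ii) ∧ (iii) holds as soon as the theta vectors lie in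
the sub-packets (`hsub`); `fullOf_contentful` — the contentfulness census (nonempty zero-free splitting monoids
when the vectors at label `1` are nonzero, nonempty number-field copies, proper shells with the `m' = 1` unit
image strictly inside, non-identity theater automorphisms, non-trivially acting (Ind1),(Ind2)-group); and the
instance of record `full1 p v_ℚ⁰ c := fullOf … (thetaVec1 p)` with both hypotheses discharged.
HONEST SCOPE: a model of the typed signatures, not of the intended objects; volumes supported at ONE place;
(i)'s multiradial compatibility holds because all vertical lines carry the same data (bi-coric strictification).
No judgement on print; no `Prop` fact; standard axioms. [claim: Mochizuki2012, status: disputed]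
[cite: ScholzeStix2018, §2.2 pp. 9–10]
-/

noncomputable section

namespace Summit.ABC

namespace IUTFork

namespace Cor312Vol

namespace NaiveProv

open Thm311 Cor312 Cor312.IdentifiedNonVacuity Literature.IUT.LogThetaLattice

variable {T : ThetaIndex} (p : ℕ) (vQ₀ : T.VQ) (c : ℝ) (θ : ThetaFamily T)

/-! ## B1. The data (a)(b)(c), the column, the full situation of a theta family -/

section Model

variable [hp : Fact p.Prime]

/-- **The data (a)(b)(c) of the model** ([IUTchIII] Thm. 3.11 (i)) over the index skeleton `T` for the theta
family `θ`: integral structures the unit cylinders `B_0` (PROPER), admissible regions the cylinders, the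
one-place log-volume `vol`; splitting monoids `PsiOf θ v` at every bad place, acting on `∏_j 𝓘^ℚ(…)` by
multiplication by the bad-place coordinates of their components; number-field copy the whole global packet
(unconstrained, as in w5-d247's and gen 2's models). [claim: Mochizuki2012, status: disputed] -/
def dataOf : MRData (signShells T) where
  shellPk := fun j vQ => pBall p j vQ 0
  shellSub := fun j v => pBall p j (T.over v) 0
  Adm := fun j vQ A => ∃ k, A = pBall p j vQ k
  logvol := fun j vQ A => vol p vQ₀ c j vQ A
  Ψ := fun v _ => PsiOf θ v
  act := fun v _ y => LinearMap.pi fun j => (bcoord v j y) • LinearMap.proj j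
  Mmod := fun _ => Set.univ

/-- The SITUATION of the theta family: sign shells over `T`, the same data on every vertical line (bi-coric
strictification), gen 2's global degrees. (An `abbrev`, so that `.L` reduces to `signShells T`.)
[claim: Mochizuki2012, status: disputed] -/
abbrev situationOf : Situation T where
  L := signShells T
  D := fun _ => dataOf p vQ₀ c θ
  G := fun _ j => degrees p c j

/-- **The column `n` of the model** ([IUTchIII] Thm. 3.11 (ii)) for the theta family `θ`: Frobenius-like data at
`(n,m)` = the coric data transported by the twist `(−1)^m ∈ Ism`; unit-group images at iterate `m'` the
cylinders `B_{m'+1}`, archimedean ball images `B_0`; Frobenioid objects w5-d247's tagged copies of `ℤ` with the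
forgetful Kummer bijections; Θ-pilot the object of index `1` (gen 2's `column`, family-generic).
[claim: Mochizuki2012, status: disputed] -/
def columnOf : Column (signShells T) where
  frobAdm := fun m j vQ A => ∃ k, twist m j vQ '' A = pBall p j vQ k
  frobLogvol := fun m j vQ A => vol p vQ₀ c j vQ (twist m j vQ '' A)
  frobΨ := fun m v _ => (signShells T).starAut (twist m) v '' PsiOf θ v
  frobMmod := fun m j => (signShells T).globalAut (twist m) j.1 '' Set.univ
  unitImage := fun _ m' j vQ => pBall p j vQ ((m' : ℤ) + 1)
  ballImage := fun _ j vQ => pBall p j vQ 0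
  ObjLGP := ℤ
  frobObjLGP := NaiveWitness.FrobObj
  kumLGP := NaiveWitness.kum
  ObjLgp := ℤ
  frobObjLgp := NaiveWitness.FrobObj
  kumLgp := NaiveWitness.kum
  thetaPilot := fun m => ⟨(1, m), rfl⟩

/-- **The full situation of [IUTchIII] Thm. 3.11** for the theta family `θ` (an `abbrev`): the situation, the
same column everywhere, w5-d247's link data `naiveLink`. [claim: Mochizuki2012, status: disputed] -/
abbrev fullOf : FullSituation T where
  toSituation := situationOf p vQ₀ c θ
  col := fun _ => columnOf p vQ₀ c θ
  link := NaiveWitness.naiveLink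

/-! ## B2. The typed Theorem 3.11 (i) ∧ (ii) ∧ (iii) holds -/

/-- (i), given that the theta vectors at the bad places lie in the sub-packets: the splitting monoids sit in the
sub-packets; the degree of `p^k𝒪` IS the global log-volume `−k·c` of its region; the classes `^{n,∘}𝔯^{LGP}`
coincide. [folklore] -/
theorem partI_of (hsub : ∀ (v : T.V), v ∈ T.Vbad → ∀ j : T.LabelStar, θ v j.1 ∈ (signShells T).SubPacket j.1 v) :
    (fullOf p vQ₀ c θ).PartI := by
  refine ⟨fun n v hv x hx j => PsiOf_subPacket θ v (hsub v hv) hx j,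
    fun n j k => ⟨fun vQ => ⟨k, rfl⟩, ?_, ?_⟩, fun _ _ => rfl⟩
  · exact GapWitnessProv.support_finite_of_ne vQ₀ fun vQ hvQ => vol_of_ne p vQ₀ c hvQ _
  · exact (finsum_vol_pBall p vQ₀ c j.1 k).symm

omit hp in
/-- (ii), column by column: KummerA = the twist fixes cylinders, KummerB = sign-saturation of `PsiOf θ v`,
KummerC = the twist is onto, (Ind3) nonarchimedean AND archimedean = `B_{m'+1} ⊆ B_0`, `B_0 ⊆ B_0`. [folklore] -/
theorem partII_of : (fullOf p vQ₀ c θ).toLatticeSituation.PartII := by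
  intro n
  refine (Column.partII_iff _ _).2 ⟨?_, fun m v hv => image_PsiOf_twist θ m v,
    fun m j => Set.image_univ_of_surjective ((signShells T).globalAut (twist m) j.1).surjective, ?_, ?_⟩
  · rintro m j vQ A ⟨k, rfl⟩
    exact ⟨⟨k, image_pBall_twist p m j vQ k⟩, by
      show vol p vQ₀ c j vQ (twist m j vQ '' pBall p j vQ k) = vol p vQ₀ c j vQ (pBall p j vQ k)
      rw [image_pBall_twist]⟩
  · exact fun m m' j vQ _ => pBall_mono p j vQ (by omega)
  · intro m j vQ _
    exact ⟨pBall_mono p j vQ (by norm_num), subset_rfl, fun m' _ => pBall_mono p j vQ (by omega)⟩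

omit hp in
/-- (iii): squares of full poly-isomorphisms commute; the Kummer isomorphism `(−1)^m` is equivariant for the
`ℤˣ`-automorphisms (an abelian commutation); full permutation poly-isomorphisms are stabilized. [folklore] -/
theorem partIII_of : (fullOf p vQ₀ c θ).PartIII := by
  refine ⟨NaiveWitness.naiveLink.partIIIa_holds, NaiveWitness.naiveLink.partIIIb_holds, ?_, ?_,
    (fullOf p vQ₀ c θ).evalCompatUpToInd_of_multiradialCompat fun _ _ => rfl⟩
  · refine NaiveWitness.naiveLink.partIIIc_of_full (fun _ => rfl) fun n m => ?_
    rintro _ ⟨a, rfl⟩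
    show NaiveWitness.unitIso a ≪≫ NaiveWitness.unitIso ((-1) ^ m.natAbs) =
      NaiveWitness.unitIso ((-1) ^ m.natAbs) ≪≫ NaiveWitness.unitIso a
    rw [NaiveWitness.unitIso_trans, NaiveWitness.unitIso_trans, mul_comm]
  · intro n m; exact Thm311.PolyIsoCalc.stabilized_full _ _

/-- **The typed Theorem 3.11 (i) ∧ (ii) ∧ (iii) HOLDS** for every theta family whose vectors at the bad places
lie in the sub-packets, over every index skeleton, prime, supported place and scale. [folklore] -/
theorem fullOf_statement
    (hsub : ∀ (v : T.V), v ∈ T.Vbad → ∀ j : T.LabelStar, θ v j.1 ∈ (signShells T).SubPacket j.1 v) :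
    (fullOf p vQ₀ c θ).Statement :=
  ⟨partI_of p vQ₀ c θ hsub, partII_of p vQ₀ c θ, partIII_of p vQ₀ c θ⟩

omit hp in
/-- CONTENTFULNESS CENSUS of the Thm-3.11 instance, as kernel conjuncts, given that the theta vectors at label
`1` are nonzero: nonempty zero-free splitting monoids at every bad place, nonempty number-field copies, proper
nonempty shells with the `m' = 1` unit image strictly inside, non-identity theater automorphisms in the link
data, a non-trivially acting (Ind1),(Ind2)-group. [folklore] -/
theorem fullOf_contentful [Fact p.Prime] (hne : ∀ v : T.V, θ v (labelOne (T := T)).1 ≠ 0) (vQ : T.VQ) :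
    (∀ (n : ℤ) (v : T.V) (hv : v ∈ T.Vbad),
        (((fullOf p vQ₀ c θ).D n).Ψ v hv).Nonempty ∧
          (0 : (signShells T).StarPacket v) ∉ ((fullOf p vQ₀ c θ).D n).Ψ v hv) ∧
      (∀ (n : ℤ) (j : T.LabelStar), (((fullOf p vQ₀ c θ).D n).Mmod j).Nonempty) ∧
      (∀ (n : ℤ) (j : T.Label) (vQ : T.VQ),
        (((fullOf p vQ₀ c θ).D n).shellPk j vQ).Nonempty ∧ ((fullOf p vQ₀ c θ).D n).shellPk j vQ ≠ Set.univ ∧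
          ∀ m : ℤ, ((fullOf p vQ₀ c θ).col n).unitImage m 1 j vQ ⊂ ((fullOf p vQ₀ c θ).D n).shellPk j vQ) ∧
      (∀ n m : ℤ, ∃ a : (fullOf p vQ₀ c θ).link.AutHT n m,
        (fullOf p vQ₀ c θ).link.onDelta n m a ≠ CategoryTheory.Iso.refl _) ∧
      (∃ Φ ∈ Setting.indGroup (fullOf p vQ₀ c θ).toSituation,
        ∃ (j : T.Label) (vQ : T.VQ) (x : (signShells T).Packet j vQ), Φ j vQ x ≠ x) := by
  refine ⟨fun n v hv => ⟨⟨thetaTupleOf θ v, thetaTupleOf_mem_PsiOf θ v⟩, zero_notMem_PsiOf θ v (hne v)⟩,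
    fun n j => ⟨0, Set.mem_univ _⟩, fun n j vQ => ⟨⟨0, zero_mem_pBall p j vQ 0⟩, pBall_ne_univ p j vQ 0, fun m => ?_⟩,
    fun n m => ⟨(-1 : ℤˣ), NaiveWitness.unitIso_neg_one_ne_refl⟩, indGroup_nontrivial p vQ₀ c vQ⟩
  show pBall p j vQ ((1 : ℕ) + 1 : ℤ) ⊂ pBall p j vQ 0
  exact (pBall_succ_ssubset p j vQ 1).trans_subset (pBall_mono p j vQ (by norm_num))

end Model

/-! ## B3. The instance of record: the one-factor theta vectors -/

/-- **The full situation OF RECORD for the pinned round** (an `abbrev`): the theta family `thetaVec1 p` — the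
theta value `q^{j²}` carried by the `α = j` tensor factor at the bad place's own summand (Part I). [claim: Mochizuki2012, status: disputed] -/
abbrev full1 (p : ℕ) (vQ₀ : T.VQ) (c : ℝ) : FullSituation T := fullOf p vQ₀ c (thetaVec1 p)

/-- **The typed Theorem 3.11 (i) ∧ (ii) ∧ (iii) HOLDS for the instance of record** (the one-factor theta vectors
lie in the sub-packets, Part I `thetaVec1_mem_subPacket`). [folklore] -/
theorem full1_statement [Fact p.Prime] : (full1 p vQ₀ c).Statement :=
  fullOf_statement p vQ₀ c (thetaVec1 p) fun v _ j => thetaVec1_mem_subPacket p v j.1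

/-- … and it is CONTENTFUL (the one-factor theta vectors are nonzero, Part I `thetaVec1_ne_zero`). [folklore] -/
theorem full1_contentful [Fact p.Prime] (vQ : T.VQ) :
    (∀ (n : ℤ) (v : T.V) (hv : v ∈ T.Vbad),
        (((full1 p vQ₀ c).D n).Ψ v hv).Nonempty ∧ (0 : (signShells T).StarPacket v) ∉ ((full1 p vQ₀ c).D n).Ψ v hv) ∧
      (∀ (n : ℤ) (j : T.LabelStar), (((full1 p vQ₀ c).D n).Mmod j).Nonempty) ∧
      (∀ (n : ℤ) (j : T.Label) (vQ : T.VQ),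
        (((full1 p vQ₀ c).D n).shellPk j vQ).Nonempty ∧ ((full1 p vQ₀ c).D n).shellPk j vQ ≠ Set.univ ∧
          ∀ m : ℤ, ((full1 p vQ₀ c).col n).unitImage m 1 j vQ ⊂ ((full1 p vQ₀ c).D n).shellPk j vQ) ∧
      (∀ n m : ℤ, ∃ a : (full1 p vQ₀ c).link.AutHT n m,
        (full1 p vQ₀ c).link.onDelta n m a ≠ CategoryTheory.Iso.refl _) ∧
      (∃ Φ ∈ Setting.indGroup (full1 p vQ₀ c).toSituation,
        ∃ (j : T.Label) (vQ : T.VQ) (x : (signShells T).Packet j vQ), Φ j vQ x ≠ x) :=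
  fullOf_contentful p vQ₀ c (thetaVec1 p) (fun v => thetaVec1_ne_zero p v _) vQ

/-- The splitting monoid of the instance of record at a bad place `v` is `PsiOf (thetaVec1 p) v` on every
vertical line (bookkeeping, `rfl`). [folklore] -/
theorem full1_Psi (n : ℤ) (v : T.V) (hv : v ∈ T.Vbad) :
    ((full1 p vQ₀ c).D n).Ψ v hv = PsiOf (thetaVec1 p) v := rfl

/-- The column-`m` Kummer image of the Frobenius-like splitting monoid of the instance of record IS the coric
splitting monoid again (the twist is a sign; Part I `image_PsiOf_twist`). [folklore] -/
theorem full1_frobΨ (n m : ℤ) :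
    ((full1 p vQ₀ c).col n).frobΨ m = fun v _ => PsiOf (thetaVec1 p) v := by
  funext v hv
  exact image_PsiOf_twist (thetaVec1 p) m v

end NaiveProv

end Cor312Vol

end IUTFork

end Summit.ABC

end
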